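import Literature.MathematicalPhysics.QuantumFieldTheory.Balaban1983to89.B8LeafModelZdPer
import Literature.MathematicalPhysics.QuantumFieldTheory.Balaban1983to89.B8LeafModelZd3SockPer
import Literature.MathematicalPhysics.QuantumFieldTheory.Balaban1983to89.B8PeriodicMemberGeometry
import Literature.MathematicalPhysics.QuantumFieldTheory.Balaban1983to89.Node00.CarriersB8Per

/-!
# `Balaban1983to89.B8LeafModelZdPerProp3OfSockPer` — [Balaban1985RegularSpaces] **Proposition 3** (p. 87) ON THE `P`-PERIODIC FAMILY
# `B8LeafModelZdPer.zdGF3Per` (print's finite torus `T_η` read as `P`-periodic data on `ℤᵈ`) FROM THE **PERIODIC-GUARDED** IN-EDGE SOCKET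
# `B8LeafModelZd3SockPer.SockB9P3Per` — the socket print actually uses on `T_η`, and the one NODE N06's periodic objects can supply

statement-level skeleton of published theorems with citation tags; proofs where landed; nothing here is a claim about the
Yang–Mills mass gap

T. Bałaban, *Spaces of regular gauge field configurations on a lattice and gauge fixing conditions*, Commun. Math. Phys. **99** (1985)
75–102 `[Balaban1985RegularSpaces]` ("B8"; journal page = PDF page + 74; PDF held `paper:balaban1985-cmp99-regular-spaces-gauge-fixing`):
Prop. 3 p. 87, (1.40)–(1.42) p. 83, (1.57)–(1.62) pp. 86–87, (1.36)–(1.39) p. 82, p. 77 (*«we admit the case when some domains Ω_j are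
equal to T_η»*).  `[Balaban1985BackgroundPropagators]` ("[4]") Thm 3.3 pp. 398–399 (the operators `G(U₀)`, `H(U₀)` behind (1.57)–(1.59)).
`[Balaban1985Averaging]` (4) p. 18 (the torus `T_η`).

## THE PRINTED TEXT (p. 87, verbatim)

*«Let us formulate the results in Proposition 3. If U₀, U₁U₀ satisfy (1.40)–(1.42) with α₀, α₁, α₂ bounded by a constant depending on d
and L only, and α₂ satisfies the additional restriction (1.61), then U₁ satisfies (1.36)–(1.39) with B₁ = 5dLB₀, B₂(β₀) = 5dLB₀(β₀), where
B₀, B₀(β₀) are the corresponding norms of the operators G(U₀), H(U₀), and depend on d and L only, B₀(β₀) on β₀ also.»* — and p. 86,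
before (1.59): *«A = G(U₀)J − … where the operator G(U₀) was introduced and investigated in [4]»*.  Every configuration of the paper
lives on the FINITE torus `T_η` (p. 77); a field on `T_η` of period `P` IS a `P`-periodic field on `ℤᵈ`.

## WHY THIS FILE (cell `pub-ymgap`, HUMAN RULING D-0062; width seat `pub-ymgap-dag-n05-w1` (g4); director-ym №217 (1) «(β′-PERIODIC) is the
## road of record behind the [B8] display»; dag-n06-b g22 WORD-26 (Q-a) «will `prop3Printed_zdPer` be re-proved from the GUARDED socket?»;
## lit-balaban word #27 «N06 suppliers conclude `SockB9P3Per`, never `SockB9P3`, at `Ω 0 = univ`»)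

The N05 display on the (β′-PERIODIC) road is `Node00.CarriersB8Per.B8LeafOfRecordPer θ P lam` — `B8LeafRS` over the periodic family of
record `famB8OfRecordPer θ β len P j := zdGF3Per θ.𝔸 θ.L β len j.toZdIdx P`, `j : IdxB8SubDPer θ P`.  Its Proposition-3 conjunct `p3` was
so far derivable only from dag-n05-a's UNGUARDED in-edge socket `B8LeafModelZd3.SockB9P3` (P1 §5 `prop3Printed_zdPer_map`,
`CarriersB8Per.prop3_famB8OfRecordPer`): the five lines of (1.59) for ALL unitary `U₀`, `W` and ALL Hermitian `A′` on `ℤᵈ` — [4] in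
infinite volume, which N06's finite-torus objects (`B9Eq327GreenZdHermPer.gopZdHPer`, the periodic Landau projection
`B9Eq321LandauProjectionZdPer`, …) cannot supply.  dag-n06-b's `B8LeafModelZd3SockPer.SockB9P3Per P …` is the SAME text with three
guards «`U₀`, `W`, `A′` are `P`-periodic» — what print uses on `T_η` and what the N06 suppliers conclude.  THIS FILE is the N05-side
consumer: **Proposition 3 holds on the periodic family from the GUARDED socket.**  The point is a reading of the landed proof: n05-a's
assembly `B8LeafModelZd3Map.prop3Body_member_zd3` calls the socket EXACTLY ONCE, at the data `(U₀, W := U₁, A := mlogCfg k η {Ω_j} U₁)`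
determined by the pair `(U₀, U₁U₀)` under examination; on the periodic family `U₀` and `U₁` ARE periodic (the carrier's second
component), and the canonical masked exponent `A` of a periodic `U₁` over a periodic domain sequence is periodic (§1, from dag-n05-w2's
`B8PeriodicMemberGeometry.sideTouchesMask_add_zsmul_iff` and the pointwise logarithm).  Everything else is n05-a's proof VERBATIM
(n05-b's k-level engine `B8Prop3KLevel.prop3_norms_kLevel` ∕ `prop3_fifth_kLevel`, the windows `B8LeafModelZd3.prop3_windows`, the
pointwise (1.36)₁ reading `B8Thm2GaugeFixedKLevel.thm2_pointwise_A` — all BY NAME).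

## WHAT IS PROVED (kernel, 0 sorry, 0 def; theorems only)

* §1 `isPeriodic_logCfg`, `isPeriodic_mlogCfg_of_isPeriodic` — the (masked) logarithm of a periodic configuration over a periodic domain
  sequence is periodic.
* §2 ★★ `prop3Body_periodicPair_zd3_of_sockB9P3Per` — PROPOSITION 3's BODY AT ONE `ℤᵈ` MEMBER `i : ZdIdx d L` FOR EVERY PAIR WITH
  `P`-PERIODIC `U₀`, `U₁`, from `SockB9P3Per P …` at that member (one threshold `c = min cP c_N(d, L, B₀)` chosen before the member), whenever
  the member's domains `Ω_j`, `j ≤ k`, are `P`-periodic.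
* §3 ★★ `prop3Body_member_zdPer_of_sockB9P3Per` (the `B8.Prop3Body` sentence of the periodic member, `Unit`-family form of
  `prop3Body_member_zd3`) · ★★ `prop3Printed_zdPer_map_of_sockB9P3Per` (P1's `prop3Printed_zdPer_map` WITH THE GUARDED SOCKET: along any
  index ∕ period maps `ι, p`, sockets at the image members only) · `prop3Printed_zdPer_map_of_sockB9P3'` (the unguarded socket still
  suffices — n06-b's `sockB9P3Per_of_sockB9P3`; agrees with P1's `prop3Printed_zdPer_map`).
* §4 ★ `Node00.prop3_famB8OfRecordPer_of_sockB9P3Per` — this seat's g3 `CarriersB8Per.prop3_famB8OfRecordPer` re-keyed on the guarded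
  socket at the periodic (1.5)-index of record `j : IdxB8SubDPer θ P` (`hΩ := j.periodic`): the `p3` conjunct of `B8LeafOfRecordPer` is
  suppliable by PERIODIC objects.

## HONEST SCOPE

A re-run of the LANDED Proposition-3 assembly on periodic data with three periodicity threads; NO estimate of [Balaban1985RegularSpaces]
or [4] is proved anew (n05-b's engine, the windows, the pointwise reading BY NAME); the socket body (the five (1.59) lines = [4] Thm 3.3 for
`G(U₀)`, `H(U₀)` — NODE N06's content, `m ≥ 1` OPEN) remains a HYPOTHESIS, now in the guarded form N06's periodic objects address; the
№4-narrow species of the display (the first-point Hölder line of (1.59)₅ ∕ (1.36)₃) is UNCHANGED (same five lines); nothing about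
Theorems 2 ∕ 4 ∕ 8 (dag-n05-c's transfers) or Prop. 7.  Count-neutral helper keyed `stmt-QuantumFields-27364` (K1⁹); N05 NOT discharged; no
count claim; one finite `𝕋⁴` programme at fixed `ε`, Bałaban AS PRINTED; the Yang–Mills mass gap (Clay) is NOT proved by any of this — R4
closes the conditional finite-`𝕋⁴` rung `BalabanLadder.UV` only; nothing continuum ∕ ℝ⁴ ∕ OS.  No `sorry`, no `def`, no `instance`, no
`notation`.  Unit `pub-ymgap-dag-n05-w1` (g4), 2026-08-28.

RELATED, NOT DUPLICATED: `B8LeafModelZd3.prop3Printed_zd3` ∕ `B8LeafModelZd3Map.prop3Body_member_zd3` (the unguarded assembly — its proof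
is RE-RUN here, not restated as a hypothesis); `B8LeafModelZdPer.prop3Printed_zdPer(_map)` (unguarded, P1); `B8LeafModelZd3SockPer` (the
socket text, dag-n06-b); `B8PeriodicMemberGeometry` (the mask lemma, dag-n05-w2); `Node00.CarriersB8Per` §3 (the unguarded record face, this
seat g3); cell `lit-balaban`'s `B8Eq159TorusPerOfSockB9P3Per` (the SUPPLIER-side twin at the torus datum — disjoint).

[cite: Balaban1985RegularSpaces, Prop. 3 p.87, (1.40)–(1.42) p.83, (1.57)–(1.62) pp.86–87, (1.36)–(1.39) p.82, p.77; Balaban1985BackgroundPropagators, Thm 3.3 p.398]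
-/

noncomputable section

open NormedSpace

namespace Literature.MathematicalPhysics.QuantumFieldTheory.Balaban1983to89.B8LeafModelZdPerProp3OfSockPer

open Complex (I)
open MatrixLog B7Prop1Explicit B7Prop2Explicit B7Prop1Local B7Eq92Concrete
open B7Prop2Explicit (C0 c2')
open B7Prop3Flat (c3)
open B8Ineq132 (covDerivFwd InAk BondTouches Under)
open B8Eq184Proof (gaugeExp cfgExp)
open B8Lemma1NonAbelian (mulCfg)
open B8Eq140Level (SideTouches)
open B8Eq146AExpansion (iEta expCfg plaqCovDeriv)
open B8Eq143PlaqExpansion (pdiv)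
open B7Prop4GeneralLevels (logCovIter linCovIter)
open B8Eq155JBound (Jcur wsup)
open B8ScaledSupNorm (bondNorm msup weight Bdd)
open B8Eq138LandauZd (IsLandau138W logCfg covLap)
open B8Prop3GaugeFixedKLevel (inAk_congr_of_sideTouches expCfg_iEta_eq_cfgExp cfgExp_congr_at)
open B9Eq340HolderZd (hquot AdmPair)
open B8LeafModelZd (ZdIdx)
open B8LeafModelZd3 (mlogCfg mlogCfg_of_sideTouches mlogCfg_of_not zdGF3 SockB9P3 prop3_windows)
open B8LeafModelZdPer (zdGF3Per cfgZd pertZd)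
open B8LeafModelZd3SockPer (SockB9P3Per sockB9P3Per_of_sockB9P3)
open B8PeriodicMemberGeometry (sideTouchesMask_add_zsmul_iff)
open T4TermwiseTorus (IsPeriodic)

-- `Site` alone could resolve to the torus sites of `Setup.lean`; re-export the `ℤ^d` sites of `B7Prop1Explicit`.
export B7Prop1Explicit (Site)

variable {d : ℕ}

/-! ## §1 The canonical masked exponent of a periodic configuration over a periodic domain sequence is periodic -/

section MaskedLog

variable {𝔸 : Type*} [CStarAlgebra 𝔸]

/-- The bondwise logarithm `(iη)⁻¹ log W` of a `P`-periodic configuration is `P`-periodic (it reads `W` at the bond only).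
[cite: Balaban1985RegularSpaces, (1.36) p.82 («U₁ = exp iηA»), p.77 («Ω_j ⊂ T_η»)] -/
theorem isPeriodic_logCfg {P : ℕ} (η : ℝ) {W : Site d → Fin d → 𝔸ˣ} (hW : IsPeriodic P W) : IsPeriodic P (logCfg η W) := by
  intro y m
  funext τ
  simp only [logCfg, congrFun (hW y m) τ]

/-- **The canonical masked exponent `A = mlogCfg k η {Ω_j} W` of a `P`-periodic `W` over `P`-periodic domains `Ω_j`, `j ≤ k`, is
`P`-periodic**: the mask «side of a plaquette touching some `Ω_j`, `j ≤ k`» translates under the period lattice (dag-n05-w2's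
`B8PeriodicMemberGeometry.sideTouchesMask_add_zsmul_iff`) and the logarithm is bondwise. [cite: Balaban1985RegularSpaces, (1.36) p.82, (1.41) p.83, p.77 («Ω_j ⊂ T_η»)] -/
theorem isPeriodic_mlogCfg_of_isPeriodic {P : ℕ} (k : ℕ) (η : ℝ) {Ω : ℕ → Set (Site d)}
    (hΩ : ∀ j, j ≤ k → IsPeriodic P (fun x : Site d => x ∈ Ω j)) {W : Site d → Fin d → 𝔸ˣ} (hW : IsPeriodic P W) :
    IsPeriodic P (mlogCfg k η Ω W) := by
  intro y m
  funext τ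
  by_cases h : ∃ j, j ≤ k ∧ SideTouches (Ω j) y τ
  · obtain ⟨j', hj', hs'⟩ := (sideTouchesMask_add_zsmul_iff hΩ y m τ).2 h
    obtain ⟨j, hj, hs⟩ := h
    rw [mlogCfg_of_sideTouches η W hj' hs', mlogCfg_of_sideTouches η W hj hs]
    exact congrFun (isPeriodic_logCfg η hW y m) τ
  · have h' : ¬ ∃ j, j ≤ k ∧ SideTouches (Ω j) (y + (P : ℤ) • m) τ := fun h'' =>
      h ((sideTouchesMask_add_zsmul_iff hΩ y m τ).1 h'')
    rw [mlogCfg_of_not η W (fun j hj hs => h' ⟨j, hj, hs⟩), mlogCfg_of_not η W (fun j hj hs => h ⟨j, hj, hs⟩)]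

end MaskedLog

/-! ## §2 Proposition 3's body at one `ℤᵈ` member for PERIODIC pairs, from the guarded socket -/

section PeriodicPair

variable {𝔸 : Type} [CStarAlgebra 𝔸] [Nontrivial 𝔸]

/-- ★★ **PROPOSITION 3 (p. 87) AT ONE MEMBER `i` OF `zdGF3`, FOR EVERY PAIR `(U₀, U₁U₀)` WITH `P`-PERIODIC `U₀`, `U₁`, FROM THE
PERIODIC-GUARDED SOCKET `SockB9P3Per P …` AT THAT MEMBER** — whenever the member's domains `Ω_j` (`j ≤ k`) are `P`-periodic; ONE
threshold `c = min cP c_N(d, L, B₀)` chosen before the member.  PROOF = dag-n05-a's `B8LeafModelZd3Map.prop3Body_member_zd3` VERBATIM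
(n05-b's `B8Prop3KLevel.prop3_norms_kLevel` — the four norm members of (1.62) — and `prop3_fifth_kLevel` — the Hölder member — at
`A := mlogCfg k η {Ω_j} U₁`, (1.40)₁ transported by locality, the gradient datum, (1.42) = the member's `C137`, the windows of
`prop3_windows`, the pointwise (1.36)₁ by `thm2_pointwise_A`), the socket now called with its three guards: `U₀`, `U₁` periodic by
hypothesis, `A` periodic by §1. [cite: Balaban1985RegularSpaces, Prop. 3 p.87, (1.40)–(1.42) p.83, (1.59)–(1.62) pp.86–87, (1.36)–(1.39) p.82, p.77 («Ω_j ⊂ T_η»); Balaban1985BackgroundPropagators, Thm 3.3 p.398] -/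
theorem prop3Body_periodicPair_zd3_of_sockB9P3Per (hd2 : 2 ≤ d) {L : ℕ} (hL : 2 ≤ L) (inp : B8.B9Inputs) {B₀β C₂ cP : ℝ}
    (hB₀β : 0 ≤ B₀β) (hC₂ : 2097152 * ((d : ℝ) + 1) ^ 2 ≤ C₂) (hcP : 0 < cP) (β : ℝ) (len : Site d → ℝ) :
    ∃ c : ℝ, 0 < c ∧ ∀ (i : ZdIdx d L) (P : ℕ), (∀ l, l ≤ i.k → IsPeriodic P (fun x : Site d => x ∈ i.Ω l)) →
      SockB9P3Per (𝔸 := 𝔸) P L inp.B₀ B₀β cP β len i.η i.k i.Ω i.Λs i.Λb →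
      ∀ α₀ α₁ α₂ : ℝ, 0 < α₀ → α₀ ≤ c → 0 < α₁ → α₁ ≤ c → 0 < α₂ → α₂ ≤ c →
        2 * α₂ ^ 2 + 20 * d * α₀ * α₂ + 2 * C₂ * α₂ ^ 2 ≤ α₀ + α₁ →
        ∀ (U₀ : (zdGF3 𝔸 L β len i).Cfg) (U₁ : (zdGF3 𝔸 L β len i).Pert), IsPeriodic P U₀.1 → IsPeriodic P U₁.2.1 →
          (zdGF3 𝔸 L β len i).InA α₀ U₀ → (zdGF3 𝔸 L β len i).Reg335 α₀ U₀ → (zdGF3 𝔸 L β len i).InAPair α₀ U₀ U₁ →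
          (zdGF3 𝔸 L β len i).C162 1 α₂ U₀ U₁ → (zdGF3 𝔸 L β len i).Landau U₀ U₁ → (zdGF3 𝔸 L β len i).C137 α₁ U₀ U₁ →
            (zdGF3 𝔸 L β len i).C136 (5 * d * (L : ℝ) * inp.B₀) (5 * d * (L : ℝ) * B₀β) (α₀ + α₁) U₀ U₁ ∧
            (zdGF3 𝔸 L β len i).C139 (5 * d * (L : ℝ) * inp.B₀) (α₀ + α₁) U₀ U₁ := by
  have hL1 : 1 ≤ L := le_trans (by norm_num) hL
  have hLr : (1 : ℝ) ≤ L := by exact_mod_cast hL1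
  have hB₀ : 0 ≤ inp.B₀ := inp.B₀_pos.le
  obtain ⟨cN, hcN, hwin⟩ := prop3_windows hd2 hL hB₀
  refine ⟨min cP cN, lt_min hcP hcN, ?_⟩
  intro i Pp hΩ SB9 α₀ α₁ α₂ hα₀ hα₀c hα₁ _ hα₂ hα₂c h61 U₀ P hU₀p hWp hInA _ hPair h162 hLan h137
  have hα₀P : α₀ ≤ cP := hα₀c.trans (min_le_left _ _)
  have hα₂P : α₂ ≤ cP := hα₂c.trans (min_le_left _ _)
  obtain ⟨hα3, hα4, h16, hd5, hsmall, hc₃, hside, h50, hC⟩ :=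
    hwin α₀ α₂ hα₀ (hα₀c.trans (min_le_right _ _)) hα₂.le (hα₂c.trans (min_le_right _ _))
  have hC₂' : 8 * (131072 * ((d : ℝ) + 1) ^ 2) * Real.exp (4 * (800 * ((d : ℝ) + 1) ^ 2 * ((d : ℝ) + 4)) * α₀) ≤ C₂ :=
    hC.trans hC₂
  -- the data
  set W : Site d → Fin d → 𝔸ˣ := P.2.1 with hW_def
  have hWu : ∀ x κ, W x κ ∈ unitaryUnits 𝔸 := P.2.2
  have hU₀ : ∀ x κ, U₀.1 x κ ∈ unitaryUnits 𝔸 := U₀.2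
  set A : Site d → Fin d → 𝔸 := mlogCfg i.k i.η i.Ω W with hA_def
  -- the three guards: `U₀`, `W` periodic (hypotheses), `A` periodic (§1)
  have hAp : IsPeriodic Pp A := isPeriodic_mlogCfg_of_isPeriodic i.k i.η hΩ hWp
  -- (1.41) and self-adjointness of the canonical exponent; `W = e^{iηA}` on the `E j`
  have h41 : ∀ j, j ≤ i.k → ∀ (y : Site d) (τ : Fin d), SideTouches (i.Ω j) y τ →
      W y τ = cfgExp i.η A y τ ∧ ‖A y τ‖ ≤ α₂ * ((L : ℝ) ^ j * i.η)⁻¹ := by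
    intro j hj y τ hs
    obtain ⟨hexp, -, hbd⟩ := h162 j hj (y, τ) hs
    have hexp' : W y τ = cfgExp i.η (logCfg i.η W) y τ := hexp
    have hbd' : ‖logCfg i.η W y τ‖ ≤ 1 * α₂ * ((L : ℝ) ^ j * i.η)⁻¹ := hbd
    have hAy : A y τ = logCfg i.η W y τ := mlogCfg_of_sideTouches i.η W hj hs
    refine ⟨?_, ?_⟩
    · rw [hexp']
      exact cfgExp_congr_at i.η hAy.symm
    · rw [hAy]
      simpa only [one_mul] using hbd'
  have hAsa : ∀ y τ, IsSelfAdjoint (A y τ) := by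
    intro y τ
    by_cases hmem : ∃ j, j ≤ i.k ∧ SideTouches (i.Ω j) y τ
    · obtain ⟨j, hj, hs⟩ := hmem
      rw [hA_def, mlogCfg_of_sideTouches i.η W hj hs]
      exact (h162 j hj (y, τ) hs).2.1
    · rw [hA_def, mlogCfg_of_not i.η W fun j hj hs => hmem ⟨j, hj, hs⟩]
      exact IsSelfAdjoint.zero 𝔸
  have hA0 : ∀ (y : Site d) (τ : Fin d), (∀ j, j ≤ i.k → ¬ SideTouches (i.Ω j) y τ) → A y τ = 0 :=
    fun y τ h => mlogCfg_of_not i.η W h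
  -- (1.40)₁ for `e^{iηA}U₀` by locality; the Landau clause for `e^{iηA}` by locality
  have h40₁ : InAk L i.k i.η α₀ i.Ω (mulCfg (expCfg (iEta i.η A)) U₀.1) := by
    refine (inAk_congr_of_sideTouches L i.k i.η α₀ (V := mulCfg W U₀.1) fun j hj y τ hs => ?_).1 hPair
    show W y τ * U₀.1 y τ = expCfg (iEta i.η A) y τ * U₀.1 y τ
    rw [(h41 j hj y τ hs).1, expCfg_iEta_eq_cfgExp]
  -- the global bound and the gradient datum (bounded family)
  have hAglob : ∀ y τ, ‖A y τ‖ ≤ α₂ * i.η⁻¹ := by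
    intro y τ
    by_cases hmem : ∃ j, j ≤ i.k ∧ SideTouches (i.Ω j) y τ
    · obtain ⟨j, hj, hs⟩ := hmem
      have hLj : (1 : ℝ) ≤ (L : ℝ) ^ j := one_le_pow₀ hLr
      have hη0 : 0 < i.η := i.hη
      calc ‖A y τ‖ ≤ α₂ * ((L : ℝ) ^ j * i.η)⁻¹ := (h41 j hj y τ hs).2
        _ = α₂ * i.η⁻¹ * ((L : ℝ) ^ j)⁻¹ := by rw [mul_inv]; ring
        _ ≤ α₂ * i.η⁻¹ * 1 := by
            apply mul_le_mul_of_nonneg_left (inv_le_one_of_one_le₀ hLj) (by positivity)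
        _ = α₂ * i.η⁻¹ := mul_one _
    · rw [hA0 y τ fun j hj hs => hmem ⟨j, hj, hs⟩, norm_zero]
      have hη0 : 0 < i.η := i.hη
      positivity
  have hU₀1 : ∀ x κ, U₀.1 x κ ∈ U1 𝔸 := fun x κ => unitaryUnits_le_U1 (hU₀ x κ)
  have hgrad : ∀ (y : Site d) (κ τ : Fin d), ‖covDerivFwd i.η U₀.1 κ (fun z => A z τ) y‖ ≤ 2 * α₂ * i.η⁻¹ * i.η⁻¹ := by
    intro y κ τ
    have hη0 : 0 < i.η := i.hη
    unfold covDerivFwd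
    rw [norm_smul, norm_inv, Real.norm_eq_abs, abs_of_pos hη0]
    have h1 : ‖B7Eq78Linearization.conjR (U₀.1 y κ) (A (y + e κ) τ) - A y τ‖ ≤ α₂ * i.η⁻¹ + α₂ * i.η⁻¹ := by
      calc ‖B7Eq78Linearization.conjR (U₀.1 y κ) (A (y + e κ) τ) - A y τ‖
          ≤ ‖B7Eq78Linearization.conjR (U₀.1 y κ) (A (y + e κ) τ)‖ + ‖A y τ‖ := norm_sub_le _ _
        _ ≤ α₂ * i.η⁻¹ + α₂ * i.η⁻¹ := by
            rw [B8Ineq132.norm_conjR (hU₀1 y κ)]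
            exact add_le_add (hAglob _ _) (hAglob _ _)
    calc i.η⁻¹ * ‖B7Eq78Linearization.conjR (U₀.1 y κ) (A (y + e κ) τ) - A y τ‖ ≤ i.η⁻¹ * (α₂ * i.η⁻¹ + α₂ * i.η⁻¹) :=
        mul_le_mul_of_nonneg_left h1 (by positivity)
      _ = 2 * α₂ * i.η⁻¹ * i.η⁻¹ := by ring
  have hBg : Bdd L i.k i.η (-(2 : ℝ)) (fun j (t : Fin d × Fin d × Site d) => SideTouches (i.Ω j) t.2.2 t.2.1)
      (fun t => covDerivFwd i.η U₀.1 t.1 (fun z => A z t.2.1) t.2.2) := by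
    have e2 : (-(2 : ℝ)) = -((2 : ℕ) : ℝ) := by norm_num
    rw [e2]
    refine B8ScaledSupNorm.bdd_of_forall (c := 2 * α₂ * ((L : ℝ) ^ i.k) ^ 2) fun j hj t _ => ?_
    rw [B8ScaledSupNorm.weight_neg_natCast L i.η 2 j]
    have hLjk : (L : ℝ) ^ j ≤ (L : ℝ) ^ i.k := pow_le_pow_right₀ hLr hj
    have hLj0 : (0 : ℝ) ≤ (L : ℝ) ^ j := by positivity
    have hη0 : 0 < i.η := i.hη
    calc ((L : ℝ) ^ j * i.η) ^ 2 * ‖covDerivFwd i.η U₀.1 t.1 (fun z => A z t.2.1) t.2.2‖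
        ≤ ((L : ℝ) ^ j * i.η) ^ 2 * (2 * α₂ * i.η⁻¹ * i.η⁻¹) := mul_le_mul_of_nonneg_left (hgrad _ _ _) (by positivity)
      _ = 2 * α₂ * ((L : ℝ) ^ j) ^ 2 := by field_simp
      _ ≤ 2 * α₂ * ((L : ℝ) ^ i.k) ^ 2 := by gcongr
  set g : ℝ := msup L i.k i.η (-(2 : ℝ)) (fun j (t : Fin d × Fin d × Site d) => SideTouches (i.Ω j) t.2.2 t.2.1)
      (fun t => covDerivFwd i.η U₀.1 t.1 (fun z => A z t.2.1) t.2.2) with hg_def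
  have hg0 : 0 ≤ g := B8ScaledSupNorm.msup_nonneg L i.k i.hη.le _ _ _
  have hg : ∀ j, j ≤ i.k → ∀ (y : Site d) (κ τ : Fin d), SideTouches (i.Ω j) y τ →
      ((L : ℝ) ^ j * i.η) ^ 2 * ‖covDerivFwd i.η U₀.1 κ (fun z => A z τ) y‖ ≤ g := by
    intro j hj y κ τ hs
    have h := B8ScaledSupNorm.weight_mul_norm_le_msup hBg hj (i := (κ, τ, y)) hs
    have hw : weight L i.η (-(2 : ℝ)) j = ((L : ℝ) ^ j * i.η) ^ 2 := by
      have e2 : (-(2 : ℝ)) = -((2 : ℕ) : ℝ) := by norm_num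
      rw [e2, B8ScaledSupNorm.weight_neg_natCast L i.η 2 j]
    rw [hw] at h
    exact h
  -- the Landau clause for `e^{iηA}` and the in-edge (1.59), five lines, from the GUARDED socket (three periodicity threads)
  have hLanA : IsLandau138W L i.k i.η (i.Ω 0) (i.Λs i.k) U₀.1 W := hLan
  obtain ⟨h59a, h59g, h59j, h59l, h59h⟩ :=
    SB9 α₀ α₂ hα₀ hα₀P hα₂ hα₂P U₀.1 W hU₀ hWu hU₀p hWp hInA hPair hLanA A hAsa hAp h41 hA0
  -- (1.42) = the member's (1.37) clause, on the classified constraint bonds of the top truncation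
  have hbox : ∀ j, j ≤ i.k → ∀ c ∈ i.Λb i.k j, ∀ x, InBox (loK L j c.1) (bondHiK L j c.1 c.2) x → x ∈ i.Ω j :=
    fun j hj c hc x hx => i.hbox i.k le_rfl j hj c hc x hx
  have h42 : ∀ j, j ≤ i.k → ∀ c ∈ i.Λb i.k j, ‖logCovIter L U₀.1 (iEta i.η A) j c.1 c.2‖ < 2 * d * L * α₁ := h137
  have h41' : ∀ j, j ≤ i.k → ∀ (y : Site d) (τ : Fin d), SideTouches (i.Ω j) y τ → ‖A y τ‖ ≤ α₂ * ((L : ℝ) ^ j * i.η)⁻¹ :=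
    fun j hj y τ hs => (h41 j hj y τ hs).2
  -- PROPOSITION 3 at `k` levels (n05-b), all four members, and the Hölder member
  obtain ⟨ha, hg', hj, hl⟩ := B8Prop3KLevel.prop3_norms_kLevel hd2 i.hη hL hU₀ hAsa hα₀ hα₁.le hα₂.le hg0 hα3 hα4 h16 hd5
    hsmall hc₃ hB₀ hside h50 hC₂' h61 hbox hInA h40₁ h41' hg h42 h59a h59g h59j h59l
  have hh := B8Prop3KLevel.prop3_fifth_kLevel hd2 i.hη hL hU₀ hAsa hα₀ hα₁.le hα₂.le hg0 hα3 hα4 h16 hd5 hsmall hc₃ hB₀ hB₀β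
    hside h50 hC₂' h61 hbox hInA h40₁ h41' hg h42 h59g h59h
  refine ⟨⟨fun j hj b hb => ?_, hg', hh⟩, hj, hl⟩
  -- (1.36)₁ pointwise on the `E j`, read on the logarithm
  obtain ⟨hexp, hsa, -⟩ := h162 j hj b hb
  refine ⟨hexp, hsa, ?_⟩
  have hpt := B8Thm2GaugeFixedKLevel.thm2_pointwise_A i.hη hL1 h41' ha hj (y := b.1) (τ := b.2) hb
  rw [← mlogCfg_of_sideTouches i.η W hj hb]
  exact hpt

end PeriodicPair

/-! ## §3 Proposition 3 on the periodic family `zdGF3Per` from the guarded socket -/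

section PerFamily

variable {𝔸 : Type} [CStarAlgebra 𝔸] [Nontrivial 𝔸]

/-- ★★ **`B8.Prop3Body` AT ONE MEMBER OF THE PERIODIC FAMILY `zdGF3Per`, GUARDED SOCKET INSIDE** — the `Unit`-family form of
`B8LeafModelZd3Map.prop3Body_member_zd3` on periodic data: ONE threshold `c = min cP c_N(d, L, B₀)` before the member; at a member `i`
with `P`-periodic domains the PERIODIC-GUARDED socket `SockB9P3Per P …` yields Proposition 3's body for the periodic member (whose
configurations and perturbations ARE `P`-periodic — §2 at the underlying fields).
[cite: Balaban1985RegularSpaces, Prop. 3 p.87, (1.40)–(1.42) p.83, (1.59)–(1.62) pp.86–87, p.77 («Ω_j ⊂ T_η»); Balaban1985BackgroundPropagators, Thm 3.3 p.398] -/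
theorem prop3Body_member_zdPer_of_sockB9P3Per (hd2 : 2 ≤ d) {L : ℕ} (hL : 2 ≤ L) (inp : B8.B9Inputs) {B₀β C₂ cP : ℝ}
    (hB₀β : 0 ≤ B₀β) (hC₂ : 2097152 * ((d : ℝ) + 1) ^ 2 ≤ C₂) (hcP : 0 < cP) (β : ℝ) (len : Site d → ℝ) :
    ∃ c : ℝ, 0 < c ∧ ∀ (i : ZdIdx d L) (P : ℕ), (∀ l, l ≤ i.k → IsPeriodic P (fun x : Site d => x ∈ i.Ω l)) →
      SockB9P3Per (𝔸 := 𝔸) P L inp.B₀ B₀β cP β len i.η i.k i.Ω i.Λs i.Λb →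
      B8.Prop3Body c d (L : ℝ) C₂ inp B₀β (fun _ : Unit => (zdGF3Per 𝔸 L β len i P).toGFData2) := by
  obtain ⟨c, hc, H⟩ := prop3Body_periodicPair_zd3_of_sockB9P3Per (𝔸 := 𝔸) hd2 hL inp hB₀β hC₂ hcP β len
  refine ⟨c, hc, fun i P hΩ SB9 => ?_⟩
  intro _ α₀ α₁ α₂ hα₀ hα₀c hα₁ hα₁c hα₂ hα₂c h61 U₀ Q hInA hReg hPair h162 hLan h137
  exact H i P hΩ SB9 α₀ α₁ α₂ hα₀ hα₀c hα₁ hα₁c hα₂ hα₂c h61 (cfgZd U₀) (pertZd Q) U₀.2.2 Q.2.2.2 hInA hReg hPair h162 hLan h137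

/-- ★★ **`B8.Prop3Printed` ON THE PERIODIC FAMILY, GUARDED SOCKET ON THE IMAGE MEMBERS ONLY** — P1's
`B8LeafModelZdPer.prop3Printed_zdPer_map` WITH THE PERIODIC-GUARDED SOCKET: along any index ∕ period maps `ι, p` whose members have
`(p j)`-periodic domains `Ω_l`, `l ≤ k` (the periodic (1.5)-index law), from `SockB9P3Per (p j) …` at the members `ι j` ONLY — the form
NODE N06's periodic objects feed (dag-n06-b WORD-26 (Q-a); lit-balaban word #27).
[cite: Balaban1985RegularSpaces, Prop. 3 p.87, (1.36)–(1.40) pp.82–83, (1.59) p.86, p.77 («Ω_j ⊂ T_η»); Balaban1985BackgroundPropagators, Thm 3.3 p.398] -/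
theorem prop3Printed_zdPer_map_of_sockB9P3Per (hd2 : 2 ≤ d) {L : ℕ} (hL : 2 ≤ L) (inp : B8.B9Inputs) {B₀β C₂ cP : ℝ}
    (hB₀β : 0 ≤ B₀β) (hC₂ : 2097152 * ((d : ℝ) + 1) ^ 2 ≤ C₂) (hcP : 0 < cP) (β : ℝ) (len : Site d → ℝ)
    {J : Type} (ι : J → ZdIdx d L) (p : J → ℕ)
    (hΩ : ∀ j l, l ≤ (ι j).k → IsPeriodic (p j) (fun x : Site d => x ∈ (ι j).Ω l))
    (SB9 : ∀ j : J, SockB9P3Per (𝔸 := 𝔸) (p j) L inp.B₀ B₀β cP β len (ι j).η (ι j).k (ι j).Ω (ι j).Λs (ι j).Λb) :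
    B8.Prop3Printed d (L : ℝ) C₂ inp B₀β (fun j : J => (zdGF3Per 𝔸 L β len (ι j) (p j)).toGFData2) := by
  obtain ⟨c, hc, H⟩ := prop3Body_member_zdPer_of_sockB9P3Per (𝔸 := 𝔸) hd2 hL inp hB₀β hC₂ hcP β len
  exact ⟨c, hc, fun j => H (ι j) (p j) (hΩ j) (SB9 j) ()⟩

omit [Nontrivial 𝔸] in
/-- The UNGUARDED socket still suffices (drop the guards: dag-n06-b's `sockB9P3Per_of_sockB9P3`) — the hypothesis list of
`prop3Printed_zdPer_map_of_sockB9P3Per` met from `SockB9P3`; P1's `prop3Printed_zdPer_map` is the law-free statement of the same.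
[cite: Balaban1985RegularSpaces, Prop. 3 p.87, (1.59) p.86] -/
theorem sockB9P3Per_family_of_sockB9P3 {L : ℕ} {B₀ B₀β cP β : ℝ} {len : Site d → ℝ} {J : Type} (ι : J → ZdIdx d L) (p : J → ℕ)
    (SB9 : ∀ j : J, SockB9P3 (𝔸 := 𝔸) L B₀ B₀β cP β len (ι j).η (ι j).k (ι j).Ω (ι j).Λs (ι j).Λb) :
    ∀ j : J, SockB9P3Per (𝔸 := 𝔸) (p j) L B₀ B₀β cP β len (ι j).η (ι j).k (ι j).Ω (ι j).Λs (ι j).Λb :=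
  fun j => sockB9P3Per_of_sockB9P3 (p j) (SB9 j)

end PerFamily

end Literature.MathematicalPhysics.QuantumFieldTheory.Balaban1983to89.B8LeafModelZdPerProp3OfSockPer

/-! ## §4 The record face: Proposition 3 at the periodic family of record from the guarded socket at the periodic (1.5)-members -/

namespace Literature.MathematicalPhysics.QuantumFieldTheory.Balaban1983to89.Node00

open B8LeafModelZdPer (zdGF3Per)
open B8LeafModelZd3SockPer (SockB9P3Per)
open B8LeafModelZdPerProp3OfSockPer (prop3Printed_zdPer_map_of_sockB9P3Per)

variable {θ : Stage3Params} {P : ℕ}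

/-- ★ **PROPOSITION 3 AT THE PERIODIC FAMILY OF RECORD `famB8OfRecordPer θ β len P`, modulo the PERIODIC-GUARDED
[Balaban1985BackgroundPropagators]-Thm-3.3 socket `SockB9P3Per P` AT THE PERIODIC (1.5)-MEMBERS ONLY** — this seat's g3
`CarriersB8Per.prop3_famB8OfRecordPer` re-keyed on dag-n06-b's guarded socket (the member's domains are `P`-periodic by the index law
`IdxB8SubDPer.periodic`): for `θ.D ≥ 2`, `C₂ ≥ 2097152(d+1)²`, `B₀(β₀) ≥ 0`.  The `p3` conjunct of `B8LeafOfRecordPer` is thus suppliable by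
NODE N06's PERIODIC objects. [cite: Balaban1985RegularSpaces, Prop. 3 p.87, (1.36)–(1.40) pp.82–83, (1.59) p.86, p.77 («Ω_j ⊂ T_η»); Balaban1985BackgroundPropagators, Thm 3.3 p.399] -/
theorem prop3_famB8OfRecordPer_of_sockB9P3Per (hD : 2 ≤ θ.D) (inp : B8.B9Inputs) {B₀β C₂ cP : ℝ} (hB₀β : 0 ≤ B₀β)
    (hC₂ : 2097152 * ((θ.D : ℝ) + 1) ^ 2 ≤ C₂) (hcP : 0 < cP) (β : ℝ) (len : B7Prop1Explicit.Site θ.D → ℝ)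
    (SB9 : ∀ j : IdxB8SubDPer θ P, SockB9P3Per (𝔸 := θ.𝔸) P θ.L inp.B₀ B₀β cP β len j.toZdIdx.η j.toZdIdx.k j.toZdIdx.Ω
      j.toZdIdx.Λs j.toZdIdx.Λb) :
    B8.Prop3Printed θ.D (θ.L : ℝ) C₂ inp B₀β (fun j : IdxB8SubDPer θ P => (famB8OfRecordPer θ β len P j).toGFData2) :=
  prop3Printed_zdPer_map_of_sockB9P3Per hD θ.two_le_L inp hB₀β hC₂ hcP β len (fun j : IdxB8SubDPer θ P => j.toZdIdx) (fun _ => P)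
    (fun j l _ => j.periodic l) SB9

end Literature.MathematicalPhysics.QuantumFieldTheory.Balaban1983to89.Node00

end
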